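import Summits.QuantumFields.YangMills.Theorems.BalabanUVNodesN08AlphaEq324RowClassSocketApprox
import Literature.MathematicalPhysics.QuantumFieldTheory.Balaban1983to89.B1Eq324BenfattoClassEntryFromCovarianceUniform

/-!
# Route «BalabanUVNodes», Track-A DAG node N08 = [Balaban1985UV3] Thm 1 p. 257 ∕ Thm 2 p. 272 — THE CLASS ROAD ∘ THE (α)-SOCKET AT EVERY RUN STEP, IN THE COVARIANCE's OWN CURRENCY:
# the (3.24) row `h324` of the edited clauses for EVERY a.e. presentation of the step block by the Gaussian field of a uniformly elliptic, bounded, exponentially decaying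
# COVARIANCE on a finite window of `ℤ^d` ([Balaban1985UV3] p. 261 «a covariance having an exponential decay property»), at EVERY step `k ≤ K`, under the threshold window
# `b₁ < b₀` — the covariance-currency twin of seat n08-w4's `…RowClassSocketEndUnitRange` (part 7 of the class socket), over seat n08-w5's
# `…ClassEntryFromCovarianceUniform.eq324_covariance_of_expDecay_on_unit` (§6)

Cell `pub-ymgap`, width seat `pub-ymgap-dag-n08-w5` gen 4 (CLAIM-3).  `bears_on: R4∕N08`; filed `--supports stmt-QuantumFields-27364` (K1⁹, helper).  THEOREMS ONLY (def-free, sorry-free,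
standard axioms); `eq324_covariance_of_expDecay_on_unit` (this seat, over n08-b's `…KernelEq324AnyGammaUnitRange.eq324_kernel_of_expDecay_on_unit`, n08-d's `…KernelEq324UnitRange.
eq324_kernel_noPad_on_unit` p640866, n08-w4's `…Eq324UnitRange` p639251, n08-c's knit, n08-d's collar, and the covariance door `…ClassEntryFromCovariance(Uniform)` of this lineage) and
part 4's `…RowClassSocketApprox.h324Row_freeLetter_of_postConsumer_ae` (p636897) consumed BY NAME.

WHY.  `…RowClassSocketEndCov` (this seat, CLAIM-1) serves the steps with `g_k ≤ η₀` in covariance currency; seat n08-w4's parts 6∕7 serve EVERY step in precision currency.  This part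
is the covariance-currency companion of part 7: EVERY step `k ≤ K` (`g_k ≤ 1`, `Scales.gK_le_one`), member presented by a COVARIANCE `Cv h U` on the window `Λ h U` — symmetric,
`g`-coercive, `Λ_G`-bounded, `|Cv e e'| ≤ K_G e^{−κ_G|e−e'|₂}` — with the field's kernel `K h U` THE ZERO-EXTENSION OF `Cv h U` ITSELF (no inverse among the hypotheses), the window
as the class road states it: `∃ b₁` (a function of the class scalars `(d, g, Λ_G, K_G, κ_G, D, ϰ, p₀, σ, c₀, n̄, κ₀)`) and the row for every threshold parameter `b₀ > b₁`.
* ★★★★ `exists_threshold_h324Row_freeLetter_of_covDecayPresentation_allSteps_ae` — `∃ b₁, ∀ b₀ > b₁, ∃ C ≥ 0, ∀ S 𝔖, ∀ k ≤ S.K, ∀ v (C·v ≤ Ca + Cc)`: member (covariance currency)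
  + a.e. presentation by `gaussianFieldOfKernel (K h U)` at threshold `p(g_k) = B10.pFun b₀ p₀ (S.gk k)` + instance (`∅ ≠ I ⊇ J`, `J ⊆ Λ`, `coefSup ≤ c₀·g_k^σ`, `|I| ≤ v·|T₁^{(k)}|`)
  ⟹ `StepAlphaEq324CoreLTAtAC.h324` ∕ `StepAlphaEq324CoreLTAt.h324` at the free letter (part 7's conclusion VERBATIM); `…_rec_one` (`p₀ = 𝔠.p₀`, σ = 1; `b₀` universal, the
  window `b₁ < b₀` a genuine condition).
HONEST SCOPE.  A composition by name (two `obtain`s + one `exact` per `(h, U)`); member ∕ presentation ∕ instance ∕ window are HYPOTHESES (IDENT = NODE 00 objects, NOT commissioned,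
NOT claimed; whether `b₁ < 𝔠.b₀` at [B10]'s data is a planners' ∕ N06 question; the N06 [Balaban1985BackgroundPropagators] in-edge would supply `(g, Λ_G, K_G, κ_G)`); nothing of
[Balaban1985UV3] ∕ [BenfattoEtAl1978] ∕ [Balaban1985BackgroundPropagators] asserted or discharged; `PrintedUV3V` NOT proved; N08 NOT discharged; count-neutral; one finite 𝕋⁴ programme
at fixed ε — R4 closes the conditional finite-𝕋⁴ rung `BalabanLadder.UV` only; nothing continuum ∕ ℝ⁴ ∕ OS ∕ mass gap ∕ Clay.

References: [Balaban1985UV3] T. Bałaban, CMP 102 (1985) 255–275 — (7) p.257, (22)–(24) pp.261–262, (56)–(58) p.270; [Balaban1982Higgs1] T. Bałaban, CMP 85 (1982) — (3.24) p.616;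
[BenfattoEtAl1978] G. Benfatto et al., CMP 59 (1978) — Lemma p.152, Appendix C (C.2)–(C.6) p.164; [Balaban1985BackgroundPropagators] T. Bałaban, CMP 99 (1985) — (1.16)–(1.18) p.180, Sect. E p.428.
-/

noncomputable section

namespace Summit.QuantumFields.YangMills.Theorems.BalabanUVNodesN08AlphaEq324RowClassSocketEndCovUnitRange

open MeasureTheory
open scoped BigOperators Nat
open Literature.MathematicalPhysics.QuantumFieldTheory (gaussianFieldOfKernel)
open Literature.MathematicalPhysics.QuantumFieldTheory.Balaban1983to89
open Literature.MathematicalPhysics.QuantumFieldTheory.Balaban1983to89.B1Sect3Statements (Eq324)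
open Literature.MathematicalPhysics.QuantumFieldTheory.Balaban1983to89.B1Eq324BenfattoLemma (Coef hamiltonian coefSup smallFieldSet cutoffBoltzmann cumulantSum)
open Literature.MathematicalPhysics.QuantumFieldTheory.Balaban1983to89.B1Eq324BenfattoClassEntryFromCovarianceUniform (eq324_covariance_of_expDecay_on_unit)
open Literature.MathematicalPhysics.QuantumFieldTheory.Balaban1985CMP102.Setting
open Summit.QuantumFields.Balaban3D.Carriers
open Summit.QuantumFields.Balaban3D.Proofs.ScalesArithmetic (gk_pos gk_le_one)
open Summit.QuantumFields.Balaban3D.Proofs.Primitives (AlphaConsts)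
open Summit.QuantumFields.Balaban3D.Proofs.GroupModelLieC (lieC)
open Summit.QuantumFields.YangMills.Theorems.BalabanUVNodesN08AlphaEq324RowClassSocketApprox (h324Row_freeLetter_of_postConsumer_ae)
open Literature.Probability.LatticeModels (cumulantOf)

variable {L : ℕ} {G : Type} [GaugeGroup G] [MeasurableSpace G] [HaarData G] (𝔊 : GroupModel G) (𝔠 : AlphaConsts L 𝔊.N) {d : ℕ}

/-- ★★★★ **THE (3.24) ROW AT EVERY RUN STEP FOR EVERY A.E. PRESENTATION BY A UNIFORMLY ELLIPTIC, BOUNDED, EXPONENTIALLY DECAYING COVARIANCE, UNDER THE THRESHOLD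
WINDOW** (the class road's covariance-side all-η `eq324_covariance_of_expDecay_on_unit` ∘ the socket's `h324Row_freeLetter_of_postConsumer_ae`; statement in the module docstring).
`b₁` depends only on `(d, g, Λ_G, K_G, κ_G, D, ϰ, p₀, σ, c₀, n̄, κ₀)`, `C` on these and `b₀`; everything about the member, the embedding, the cut-off set and the Hamiltonian letters may
depend on `(h, U)`; the field's kernel `K h U` is the zero-extension of the covariance `Cv h U` itself.
[cite: Balaban1985UV3, (7) p.257 + (22)–(24) pp.261–262 («a covariance having an exponential decay property») + (41) p.266 + (58) p.270; Balaban1982Higgs1, (3.24) p.616; BenfattoEtAl1978, Lemma p.152, Appendix C (C.2)–(C.6) p.164 (class form; ours); Balaban1985BackgroundPropagators, (1.16)–(1.18) p.180, Sect. E p.428] -/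
theorem exists_threshold_h324Row_freeLetter_of_covDecayPresentation_allSteps_ae (hd : 0 < d) {g ΛG KG κG : ℝ} (hg0 : 0 < g) (hΛG0 : 0 < ΛG) (hKG : 0 ≤ KG)
    (hκG : 0 < κG) (D : ℕ) {ϰ : ℝ} (hϰ : 0 < ϰ) {p₀ σ c₀ : ℝ} (hp₀ : 2 / 3 < p₀) (hσ : 0 < σ) (hc₀ : 0 ≤ c₀) (hκσ : 6 + 2 * 𝔠.κ₀ < σ * (𝔠.nbar + 1)) :
    ∃ b₁ : ℝ, ∀ b₀ : ℝ, b₁ < b₀ → ∃ C : ℝ, 0 ≤ C ∧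
      ∀ (S : Scales L) (𝔖 : ∀ k, StepSeries S G ↥(lieC 𝔊) (nblkOf S 𝔠.lane.carrier k) k) (k : ℕ), k ≤ S.K → ∀ (v : ℝ), C * v ≤ 𝔠.Ca + 𝔠.Cc →
        ∀ (Λ : Hist S.P (k + 1) → GaugeField S.P (k + 1) G → Finset (Fin d → ℤ))
          (Cv : ∀ h U, Matrix ↥(Λ h U) ↥(Λ h U) ℝ) (K : Hist S.P (k + 1) → GaugeField S.P (k + 1) G → (Fin d → ℤ) → (Fin d → ℤ) → ℝ)
          (Φ : Hist S.P (k + 1) → GaugeField S.P (k + 1) G → ((Fin d → ℤ) → ℝ) → (𝔖 k).Fl)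
          (s : ℕ) (I J : Hist S.P (k + 1) → GaugeField S.P (k + 1) G → Finset (Fin d → ℤ))
          (a : Hist S.P (k + 1) → GaugeField S.P (k + 1) G → Coef d),
          -- the members (covariance currency: the kernel IS the covariance, zero-extended; `Λ ≠ ∅`; symmetric; `g`-coercive; `Λ_G`-bounded; exponentially decaying)
          (∀ h U x y, K h U x y = if hxy : x ∈ Λ h U ∧ y ∈ Λ h U then Cv h U ⟨x, hxy.1⟩ ⟨y, hxy.2⟩ else 0) →
          (∀ h U, (Λ h U).Nonempty) → (∀ h U e e', Cv h U e e' = Cv h U e' e) →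
          (∀ h U (x : ↥(Λ h U) → ℝ), g * ∑ e, x e ^ 2 ≤ ∑ e, ∑ e', Cv h U e e' * x e * x e') →
          (∀ h U (x : ↥(Λ h U) → ℝ), ∑ e, ∑ e', Cv h U e e' * x e * x e' ≤ ΛG * ∑ e, x e ^ 2) →
          (∀ h U (e e' : ↥(Λ h U)), |Cv h U e e'| ≤ KG * Real.exp (-(κG * Real.sqrt (∑ j, ((((e : Fin d → ℤ) j : ℝ) - ((e' : Fin d → ℤ) j : ℝ))) ^ 2)))) →
          -- the a.e. presentation
          (∀ h U, Measurable (Φ h U)) → (∀ h U, (𝔖 k).μ = (gaussianFieldOfKernel (K h U)).map (Φ h U)) →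
          (∀ h, MeasurableSet ((𝔖 k).box h)) → (∀ h U, Measurable ((𝔖 k).𝒱 h U)) →
          (∀ h U, Φ h U ⁻¹' (𝔖 k).box h =ᵐ[gaussianFieldOfKernel (K h U)] smallFieldSet (I h U) (B10.pFun b₀ p₀ (S.gk k))) →
          (∀ h U, (fun z => (𝔖 k).𝒱 h U (Φ h U z)) =ᵐ[gaussianFieldOfKernel (K h U)] hamiltonian s D ϰ (a h U) (J h U)) →
          -- the instance data
          (∀ h U, (I h U).Nonempty) → (∀ h U, J h U ⊆ I h U) → (∀ h U, J h U ⊆ Λ h U) →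
          (∀ h U, coefSup s D (a h U) (J h U) ≤ c₀ * S.gk k ^ σ) → (∀ h U, ((I h U).card : ℝ) ≤ v * S.sites k) →
          ∀ h (U : GaugeField S.P (k + 1) G),
            Eq324 (∫ ω in (𝔖 k).box h, Real.exp ((𝔖 k).𝒱 h U ω) ∂(𝔖 k).μ)
              (fun n => cumulantOf (fun m => ∫ ω, (𝔖 k).𝒱 h U ω ^ m ∂(𝔖 k).μ) n) 𝔠.nbar (𝔠.Ca + 𝔠.Cc)
              ((L : ℝ) ^ k * S.g0sq) (3 + 𝔠.κ₀) (S.sites k) := by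
  obtain ⟨b₁, hb₁⟩ :=
    eq324_covariance_of_expDecay_on_unit (d := d) hd hg0 hΛG0 hKG hκG 𝔠.nbar D hϰ hp₀ hσ hc₀ (κ := 6 + 2 * 𝔠.κ₀) (by linarith [𝔠.κ₀_pos]) hκσ
  refine ⟨b₁, fun b₀ hb => ?_⟩
  obtain ⟨C, hC, hE⟩ := hb₁ b₀ hb
  refine ⟨C, hC, ?_⟩
  intro S 𝔖 k hk v hCv Λ Cv K Φ s I J a hK hΛ hGs hg hΛG hdec hΦ hμ hboxm hVm hbox hV hI hJI hJΛ hA hIv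
  refine h324Row_freeLetter_of_postConsumer_ae 𝔊 𝔠 𝔖 k hC hCv (fun h U => gaussianFieldOfKernel (K h U)) Φ hΦ hμ hboxm hVm I hbox
    (fun h U => hamiltonian s D ϰ (a h U) (J h U)) hV hIv fun h U => ?_
  exact hE (S.gk k) (gk_pos S k) (gk_le_one S S.gK_le_one k hk) (hK h U) (hΛ h U) (hGs h U) (hg h U) (hΛG h U) (hdec h U) s (I h U) (J h U)
    (a h U) (hI h U) (hJI h U) (hJΛ h U) (hA h U)

/-- **… AT THE RECORD's OWN `p₀ = 𝔠.p₀` AND `σ = 1`** (`5 + 2κ₀ < n̄`), covariance currency, the threshold parameter `b₀` kept universal so the window stays a genuine condition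
(instantiate `b₀ := 𝔠.b₀` with a proof of `b₁ < 𝔠.b₀`). [cite: Balaban1985UV3, (7) p.257 + (22)–(24) pp.261–262 + (56)–(58) p.270; Balaban1982Higgs1, (3.24) p.616; BenfattoEtAl1978, Lemma p.152 (class form; ours)] -/
theorem exists_threshold_h324Row_freeLetter_of_covDecayPresentation_allSteps_ae_rec_one (hd : 0 < d) {g ΛG KG κG : ℝ} (hg0 : 0 < g) (hΛG0 : 0 < ΛG)
    (hKG : 0 ≤ KG) (hκG : 0 < κG) (D : ℕ) {ϰ : ℝ} (hϰ : 0 < ϰ) {c₀ : ℝ} (hc₀ : 0 ≤ c₀) (hn : 5 + 2 * 𝔠.κ₀ < 𝔠.nbar) :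
    ∃ b₁ : ℝ, ∀ b₀ : ℝ, b₁ < b₀ → ∃ C : ℝ, 0 ≤ C ∧
      ∀ (S : Scales L) (𝔖 : ∀ k, StepSeries S G ↥(lieC 𝔊) (nblkOf S 𝔠.lane.carrier k) k) (k : ℕ), k ≤ S.K → ∀ (v : ℝ), C * v ≤ 𝔠.Ca + 𝔠.Cc →
        ∀ (Λ : Hist S.P (k + 1) → GaugeField S.P (k + 1) G → Finset (Fin d → ℤ))
          (Cv : ∀ h U, Matrix ↥(Λ h U) ↥(Λ h U) ℝ) (K : Hist S.P (k + 1) → GaugeField S.P (k + 1) G → (Fin d → ℤ) → (Fin d → ℤ) → ℝ)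
          (Φ : Hist S.P (k + 1) → GaugeField S.P (k + 1) G → ((Fin d → ℤ) → ℝ) → (𝔖 k).Fl)
          (s : ℕ) (I J : Hist S.P (k + 1) → GaugeField S.P (k + 1) G → Finset (Fin d → ℤ))
          (a : Hist S.P (k + 1) → GaugeField S.P (k + 1) G → Coef d),
          (∀ h U x y, K h U x y = if hxy : x ∈ Λ h U ∧ y ∈ Λ h U then Cv h U ⟨x, hxy.1⟩ ⟨y, hxy.2⟩ else 0) →
          (∀ h U, (Λ h U).Nonempty) → (∀ h U e e', Cv h U e e' = Cv h U e' e) →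
          (∀ h U (x : ↥(Λ h U) → ℝ), g * ∑ e, x e ^ 2 ≤ ∑ e, ∑ e', Cv h U e e' * x e * x e') →
          (∀ h U (x : ↥(Λ h U) → ℝ), ∑ e, ∑ e', Cv h U e e' * x e * x e' ≤ ΛG * ∑ e, x e ^ 2) →
          (∀ h U (e e' : ↥(Λ h U)), |Cv h U e e'| ≤ KG * Real.exp (-(κG * Real.sqrt (∑ j, ((((e : Fin d → ℤ) j : ℝ) - ((e' : Fin d → ℤ) j : ℝ))) ^ 2)))) →
          (∀ h U, Measurable (Φ h U)) → (∀ h U, (𝔖 k).μ = (gaussianFieldOfKernel (K h U)).map (Φ h U)) →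
          (∀ h, MeasurableSet ((𝔖 k).box h)) → (∀ h U, Measurable ((𝔖 k).𝒱 h U)) →
          (∀ h U, Φ h U ⁻¹' (𝔖 k).box h =ᵐ[gaussianFieldOfKernel (K h U)] smallFieldSet (I h U) (B10.pFun b₀ 𝔠.p₀ (S.gk k))) →
          (∀ h U, (fun z => (𝔖 k).𝒱 h U (Φ h U z)) =ᵐ[gaussianFieldOfKernel (K h U)] hamiltonian s D ϰ (a h U) (J h U)) →
          (∀ h U, (I h U).Nonempty) → (∀ h U, J h U ⊆ I h U) → (∀ h U, J h U ⊆ Λ h U) →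
          (∀ h U, coefSup s D (a h U) (J h U) ≤ c₀ * S.gk k) → (∀ h U, ((I h U).card : ℝ) ≤ v * S.sites k) →
          ∀ h (U : GaugeField S.P (k + 1) G),
            Eq324 (∫ ω in (𝔖 k).box h, Real.exp ((𝔖 k).𝒱 h U ω) ∂(𝔖 k).μ)
              (fun n => cumulantOf (fun m => ∫ ω, (𝔖 k).𝒱 h U ω ^ m ∂(𝔖 k).μ) n) 𝔠.nbar (𝔠.Ca + 𝔠.Cc)
              ((L : ℝ) ^ k * S.g0sq) (3 + 𝔠.κ₀) (S.sites k) := by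
  obtain ⟨b₁, hb₁⟩ :=
    exists_threshold_h324Row_freeLetter_of_covDecayPresentation_allSteps_ae 𝔊 𝔠 (d := d) hd hg0 hΛG0 hKG hκG D hϰ (p₀ := 𝔠.p₀) (σ := 1)
      (by linarith [𝔠.two_lt_p₀]) one_pos hc₀ (by linarith)
  refine ⟨b₁, fun b₀ hb => ?_⟩
  obtain ⟨C, hC, h⟩ := hb₁ b₀ hb
  refine ⟨C, hC, ?_⟩
  intro S 𝔖 k hk v hCv Λ Cv K Φ s I J a hK hΛ hGs hg hΛG hdec hΦ hμ hboxm hVm hbox hV hI hJI hJΛ hA hIv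
  exact h S 𝔖 k hk v hCv Λ Cv K Φ s I J a hK hΛ hGs hg hΛG hdec hΦ hμ hboxm hVm hbox hV hI hJI hJΛ
    (fun h' U => by rw [Real.rpow_one]; exact hA h' U) hIv

end Summit.QuantumFields.YangMills.Theorems.BalabanUVNodesN08AlphaEq324RowClassSocketEndCovUnitRange

end
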